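import Mathlib
import Summits.Ventures.HodgeRepro.Tier4.Target
import Summits.Ventures.HodgeRepro.Tier4.Line3.Defs
import Summits.Ventures.HodgeRepro.Tier4.Line3.DefsLemmas
import Summits.Ventures.HodgeRepro.Tier4.Line3.KMDatum
import Summits.Ventures.HodgeRepro.Tier4.Line3.KMDatumS
import Summits.Ventures.HodgeRepro.Tier4.Line3.HeckeEquivarianceLemmas
import Summits.Ventures.HodgeRepro.Tier4.Line3.ClassBoundGauss
import Summits.Ventures.HodgeRepro.Tier4.Line3.Majorant
import Summits.Ventures.HodgeRepro.Tier4.Line3.SylvesterTransfer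
import Summits.Ventures.HodgeRepro.Tier4.Line3.UnitCopyScaling
import Summits.Ventures.HodgeRepro.Tier4.Line3.UnitCopyPos
import Summits.Ventures.HodgeRepro.Tier4.Line3.CopyRemainder
import Summits.Ventures.HodgeRepro.Tier4.Line3.GaussRatioFormula
import Summits.Ventures.HodgeRepro.Tier4.Line3.CopyWeightBound

/-!
# Tier4/Line3/CopyWeightGaussian — the weight of a non-shrinking copy against the main term, WITH the `τ₀`-Gaussian

Blind re-derivation cell `pub-hodge-repro`, Tier 4 «PROVE THE STEP», LINE L3, seat t4-x2 (g3, reserve wall-breaker; bus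
S13860 (F2)).  t4-L3-p2's `CopyWeightBound.weight_le_of_one_le_norm` bounds the `N`-free weight of a copy with non-shrinking
scalars (`‖τ₀ ε_j‖ ≥ 1`) by `(∏ ‖τ₀ ε_j‖²) ‖Λ‖ e^{−π defSize} · Re I_∞(xm)`, dropping the `τ₀`-Gaussian of the kernel
scaling (`maj ≥ 0` only).  Here the coercivity of the majorant, `maj y z ≥ |(y, y)_J|` (Majorant `rung_abs_le_maj`), and
the Sylvester transfer `‖(y x, y x)_J‖ = ‖τ₀ ⟨x, x⟩_H‖` (SylvesterTransfer `norm_ballCoord_J`) are kept, so that the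
bound carries the FULL size profile of the centre:

  `weight c o ≤ (∏_j ‖τ₀ ε_j‖²) · ‖Λ(o)‖ · exp(−π · profileExc ε xm) · Re I_∞(xm)`,

  `profileExc ε xm = Σ_j (‖τ₀ ε_j‖² − 1) · tauSize (xm j) + defSize ε xm`,
  `tauSize x = ‖τ₀ ⟨x, x⟩_H‖`, `defSize ε xm = Σ_j Σ_{σ ≠ τ₀, τ̄₀} (‖σ ε_j‖² − 1) · defQuad σ (xm j)`.

`profileExc` is a LINEAR form in the centre's size profile `(tauSize (xm j); defQuad σ (xm j))_{j, σ}` with coefficients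
`(‖σ ε_j‖² − 1)`; it is NEGATIVE when a definite size `‖σ ε_j‖` is `< 1` and the definite profile dominates (the
amplification of bus S13860 (F1): the definite-deep centre of proofs/t4/L3/SATURATION-SCALAR-FAMILY-x2.md §9 (c) is NOT
a valid choice), and `ArchCopyBound` with `θ₁ < 1` needs `profileExc > 0` on every non-torsion unit tuple — the profile
condition of S13860 (F2).  `tauSize_pos` (anisotropy) and `tauSize_le_maj` are the two facts about the `τ₀`-size.

Nothing here says anything about the status of the Hodge conjecture for CM abelian varieties, which is NOT proved
(HC_CM is NOT proved by anyone in this repository).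
-/

set_option autoImplicit false

noncomputable section

namespace Summit.Ventures.HodgeRepro.Tier4.Line3

open Summit.Ventures.HodgeRepro.Tier4
open Matrix NumberField MeasureTheory
open scoped ComplexConjugate

/-- The `J`-form of a vector is real: `(y, y)_J = ((y, y)_J).re`. -/
theorem hformJ_eq_re (y : Fin 3 → ℂ) : star y ⬝ᵥ (J *ᵥ y) = (((star y ⬝ᵥ (J *ᵥ y)).re : ℝ) : ℂ) := by
  apply Complex.ext
  · simp
  · simp [dotProduct, J, Matrix.mulVec_diagonal, Fin.sum_univ_three, Complex.mul_im, Complex.conj_re,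
      Complex.conj_im]
    ring

/-- `‖(y, y)_J‖ = |((y, y)_J).re|`. -/
theorem norm_hformJ_eq_abs_re (y : Fin 3 → ℂ) : ‖star y ⬝ᵥ (J *ᵥ y)‖ = |(star y ⬝ᵥ (J *ᵥ y)).re| := by
  conv_lhs => rw [hformJ_eq_re y]
  rw [Complex.norm_real, Real.norm_eq_abs]

namespace T4Data

variable (X : T4Data)

/-- **THE `τ₀`-SIZE OF A VECTOR**: `‖τ₀ ⟨x, x⟩_H‖` — the coercivity constant of the majorant at `y(x)`. -/
def tauSize (x : Fin 3 → X.E) : ℝ := ‖X.τ₀ (hform X.c X.H x x)‖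

/-- The `τ₀`-size is non-negative. -/
theorem tauSize_nonneg (x : Fin 3 → X.E) : 0 ≤ X.tauSize x := norm_nonneg _

/-- The `τ₀`-size of a non-zero vector is positive (anisotropy of `H`). -/
theorem tauSize_pos {x : Fin 3 → X.E} (hx : x ≠ 0) : 0 < X.tauSize x := by
  unfold tauSize
  rw [norm_pos_iff, map_ne_zero]
  exact fun h => hx (X.hAn x h)

/-- **COERCIVITY OF THE MAJORANT**: `tauSize x ≤ maj (y x) z` on the ball (`rung_abs_le_maj` + the Sylvester transfer). -/
theorem tauSize_le_maj (x : Fin 3 → X.E) {z : Fin 2 → ℂ} (hz : z ∈ ball) :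
    X.tauSize x ≤ maj (X.ballCoord x) z := by
  unfold tauSize
  rw [← X.norm_ballCoord_J, norm_hformJ_eq_abs_re]
  exact rung_abs_le_maj _ _ hz

/-- **THE PROFILE EXPONENT** of the copy `ε • x`: the `τ₀`-part `Σ_j (‖τ₀ ε_j‖² − 1) · tauSize (x j)` plus the definite
part `defSize ε x`. -/
def profileExc (ε : Fin 4 → X.E) (x : X.Tuple) : ℝ :=
  (∑ j, (‖X.τ₀ (ε j)‖ ^ 2 - 1) * X.tauSize (x j)) + X.defSize ε x

/-- The `τ₀`-part of the profile exponent of a non-shrinking copy is non-negative. -/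
theorem sum_tau_part_nonneg {ε : Fin 4 → X.E} (hε : ∀ j, 1 ≤ ‖X.τ₀ (ε j)‖) (x : X.Tuple) :
    0 ≤ ∑ j, (‖X.τ₀ (ε j)‖ ^ 2 - 1) * X.tauSize (x j) := by
  refine Finset.sum_nonneg fun j _ => mul_nonneg ?_ (X.tauSize_nonneg _)
  nlinarith [hε j, norm_nonneg (X.τ₀ (ε j))]

/-- On the ball, the kernel scaling factor of a copy with `‖τ₀ ε_j‖ ≥ 1` is at most
`∏_j ‖τ₀ ε_j‖² · exp(−π (‖τ₀ ε_j‖² − 1) · tauSize (x j))` — the `τ₀`-Gaussian survives. -/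
theorem kernelScale_le_gaussian_of_one_le_norm {ε : Fin 4 → X.E} (hε : ∀ j, 1 ≤ ‖X.τ₀ (ε j)‖) (x : X.Tuple)
    {z : Fin 2 → ℂ} (hz : z ∈ ball) :
    X.kernelScale ε x z ≤
      ∏ j, (‖X.τ₀ (ε j)‖ ^ 2 * Real.exp (-(Real.pi * ((‖X.τ₀ (ε j)‖ ^ 2 - 1) * X.tauSize (x j))))) := by
  unfold kernelScale
  refine Finset.prod_le_prod (fun j _ => mul_nonneg (pow_nonneg (norm_nonneg _) 2) (Real.exp_pos _).le)
    fun j _ => ?_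
  refine mul_le_mul_of_nonneg_left (Real.exp_le_exp.2 ?_) (pow_nonneg (norm_nonneg _) 2)
  have h1 : 0 ≤ ‖X.τ₀ (ε j)‖ ^ 2 - 1 := by nlinarith [hε j, norm_nonneg (X.τ₀ (ε j))]
  have h2 : X.tauSize (x j) ≤ maj (X.ballCoord (x j)) z := X.tauSize_le_maj (x j) hz
  have h3 : (‖X.τ₀ (ε j)‖ ^ 2 - 1) * X.tauSize (x j) ≤ (‖X.τ₀ (ε j)‖ ^ 2 - 1) * maj (X.ballCoord (x j)) z :=
    mul_le_mul_of_nonneg_left h2 h1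
  nlinarith [Real.pi_pos, h3]

/-- The product of the per-slot `τ₀`-Gaussians is `(∏ ‖τ₀ ε_j‖²) · exp(−π Σ_j (‖τ₀ ε_j‖² − 1) tauSize (x j))`. -/
theorem prod_tau_gaussian_eq (ε : Fin 4 → X.E) (x : X.Tuple) :
    (∏ j, (‖X.τ₀ (ε j)‖ ^ 2 * Real.exp (-(Real.pi * ((‖X.τ₀ (ε j)‖ ^ 2 - 1) * X.tauSize (x j)))))) =
      (∏ j, ‖X.τ₀ (ε j)‖ ^ 2) * Real.exp (-(Real.pi * ∑ j, (‖X.τ₀ (ε j)‖ ^ 2 - 1) * X.tauSize (x j))) := by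
  rw [Finset.prod_mul_distrib, Finset.mul_sum, ← Finset.sum_neg_distrib, Real.exp_sum]

/-- **THE WEIGHT OF A COPY WITH NON-SHRINKING SCALARS AT `τ₀`, AGAINST THE MAIN TERM, WITH THE FULL PROFILE.** -/
theorem weight_le_gaussian_of_one_le_norm (D : X.ThetaData) (S : Set (Fin 4 → X.E)) (xm : X.Tuple)
    (h02 : xm 2 = xm 0) (h13 : xm 3 = xm 1) (hint : IntegrableOn (fun z => X.kernel D.Φ xm z) ball)
    (c : X.CopyData D S xm) (o : X.Orbit) (hε : ∀ j, 1 ≤ ‖X.τ₀ (c.rep o j)‖) :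
    c.weight o ≤ (∏ j, ‖X.τ₀ (c.rep o j)‖ ^ 2) * ‖c.lam o 0 * c.lam o 1 * conj (c.lam o 2 * c.lam o 3)‖ *
      Real.exp (-(Real.pi * X.profileExc (c.rep o) xm)) * (∫ z in ball, X.kernel D.Φ xm z).re := by
  unfold CopyData.weight
  -- the constant in front of the kernel
  set A : ℝ := (∏ j, ‖X.τ₀ (c.rep o j)‖ ^ 2) *
    Real.exp (-(Real.pi * ∑ j, (‖X.τ₀ (c.rep o j)‖ ^ 2 - 1) * X.tauSize (xm j))) with hA
  have hA0 : 0 ≤ A := mul_nonneg (Finset.prod_nonneg fun _ _ => pow_nonneg (norm_nonneg _) 2) (Real.exp_pos _).le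
  -- bound the kernel factor
  have hk : ‖∫ z in ball, ((X.kernelScale (c.rep o) xm z : ℝ) : ℂ) * X.kernel D.Φ xm z‖ ≤
      A * (∫ z in ball, X.kernel D.Φ xm z).re := by
    refine (norm_integral_le_integral_norm _).trans ?_
    have hre : (∫ z in ball, X.kernel D.Φ xm z).re = ∫ z in ball, ‖X.kernel D.Φ xm z‖ := by
      simp_rw [X.kernel_symm D.Φ xm h02 h13, integral_complex_ofReal, Complex.ofReal_re, Complex.norm_real,
        Real.norm_of_nonneg (Complex.normSq_nonneg _)]
    rw [hre, ← integral_const_mul]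
    refine integral_mono_of_nonneg (Filter.Eventually.of_forall fun z => norm_nonneg _)
      (hint.norm.const_mul _) ?_
    refine ae_restrict_of_forall_mem HeckeEquivariance.isOpen_ball'.measurableSet fun z hz => ?_
    show ‖((X.kernelScale (c.rep o) xm z : ℝ) : ℂ) * X.kernel D.Φ xm z‖ ≤ A * ‖X.kernel D.Φ xm z‖
    rw [norm_mul, Complex.norm_real, Real.norm_eq_abs, abs_of_nonneg (X.kernelScale_nonneg _ _ _)]
    refine mul_le_mul_of_nonneg_right ?_ (norm_nonneg _)
    rw [hA, ← X.prod_tau_gaussian_eq]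
    exact X.kernelScale_le_gaussian_of_one_le_norm hε xm hz
  -- the Gaussian ratio as an exponential of the definite part, and the profile exponent as a sum
  have hprof : Real.exp (-(Real.pi * X.profileExc (c.rep o) xm)) =
      Real.exp (-(Real.pi * ∑ j, (‖X.τ₀ (c.rep o j)‖ ^ 2 - 1) * X.tauSize (xm j))) *
        Real.exp (-(Real.pi * X.defSize (c.rep o) xm)) := by
    rw [← Real.exp_add]
    unfold profileExc
    ring_nf
  calc ‖∫ z in ball, ((X.kernelScale (c.rep o) xm z : ℝ) : ℂ) * X.kernel D.Φ xm z‖ *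
        ‖c.lam o 0 * c.lam o 1 * conj (c.lam o 2 * c.lam o 3)‖ * X.gaussRatio (c.rep o) xm
      ≤ (A * (∫ z in ball, X.kernel D.Φ xm z).re) *
        ‖c.lam o 0 * c.lam o 1 * conj (c.lam o 2 * c.lam o 3)‖ * X.gaussRatio (c.rep o) xm := by
          gcongr
          exact (X.gaussRatio_pos _ _).le
    _ = (∏ j, ‖X.τ₀ (c.rep o j)‖ ^ 2) * ‖c.lam o 0 * c.lam o 1 * conj (c.lam o 2 * c.lam o 3)‖ *
        Real.exp (-(Real.pi * X.profileExc (c.rep o) xm)) * (∫ z in ball, X.kernel D.Φ xm z).re := by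
          rw [hprof, X.gaussRatio_eq_exp, hA]
          ring

open scoped Classical in
/-- **THE PROFILE EXPONENT AS A LINEAR FORM IN THE CENTRE'S SIZES** (the shape of bus S13860 (F2)): for a tuple `ε` the
coefficient of the `τ₀`-size of slot `j` is `‖τ₀ ε_j‖² − 1` and that of the definite size at `σ` is `‖σ ε_j‖² − 1`; a
definite size `‖σ ε_j‖ < 1` contributes NEGATIVELY. -/
theorem profileExc_eq (ε : Fin 4 → X.E) (x : X.Tuple) :
    X.profileExc ε x = ∑ j, ((‖X.τ₀ (ε j)‖ ^ 2 - 1) * X.tauSize (x j) +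
      ∑ σ ∈ Finset.univ.filter (fun σ : X.E →+* ℂ => σ ≠ X.τ₀ ∧ σ ≠ conjEmb X.τ₀),
        (‖σ (ε j)‖ ^ 2 - 1) * X.defQuad σ (x j)) := by
  unfold profileExc defSize
  rw [← Finset.sum_add_distrib]

/-- The definite-size coefficient is negative exactly when `‖σ ε_j‖ < 1`: the monotonicity behind (F1) — with the
`τ₀`-part fixed, enlarging the definite size `q` at such a `σ` LOWERS the profile exponent (and so raises the weight
bound, and the weight itself for the genuine data). -/
theorem coeff_neg_of_norm_lt_one {a : ℂ} (ha : ‖a‖ < 1) {q q' : ℝ} (hq : q ≤ q') :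
    (‖a‖ ^ 2 - 1) * q' ≤ (‖a‖ ^ 2 - 1) * q := by
  have h : ‖a‖ ^ 2 - 1 ≤ 0 := by nlinarith [norm_nonneg a]
  exact mul_le_mul_of_nonpos_left hq h

end T4Data

end Summit.Ventures.HodgeRepro.Tier4.Line3

end
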